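import Summits.KontsevichZagierPeriods.KontsevichZagierPeriods.Theses.UnfoldedStokes
import Summits.KontsevichZagierPeriods.KontsevichZagierPeriods.Theorems.UnfoldedStokesStokesGenerationStubCubifyKernel
import Summits.KontsevichZagierPeriods.KontsevichZagierPeriods.Theorems.UnfoldedStokesStokesGenerationStubFibrewiseStokesCalibration
import Summits.KontsevichZagierPeriods.KontsevichZagierPeriods.Theorems.UnfoldedStokesStokesGenerationLineReduction
import Summits.KontsevichZagierPeriods.KontsevichZagierPeriods.Theorems.FibrewiseStokesGenerationConjecture
import Summits.KontsevichZagierPeriods.KontsevichZagierPeriods.Theorems.StokesGeneration.Negative.IffSummit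
import Literature.NumberTheory.Transcendental.KZLogCalculusProofs

/-!
# `StokesGeneration` (stmt-3586), line `fibrewise_stokes`: the BRIDGE from the residual conjecture

Sorry-free composition of the line `fibrewise_stokes` (`Cruxes/StokesGeneration/Lines/fibrewise_stokes.lean`)
with its two provable stubs DISCHARGED by landed theorems — S1 `stub_cubifyKernel`
(`…StubCubifyKernel.lean`) and S3 `stub_fibrewiseStokesCalibration`
(`…StubFibrewiseStokesCalibration.lean`) — and its residual S2 taken as the registered summit-side
conjecture `FibrewiseStokesGenerationConjecture` (`Theorems/FibrewiseStokesGenerationConjecture.lean`):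

* `stokesGeneration_of_fibrewiseStokesGenerationConjecture : FibrewiseStokesGenerationConjecture → StokesGeneration`
  (`eval x = 0` ⇒ (S1) `x ≡ [□ᴹ, h]`, `h` bounded, `∫ h = 0` by soundness ⇒ (S2) on `□^{M'}`,
  `h ∘ pr = Σⱼ (Dⱼ − (Gⱼ|₁ − Gⱼ|₀))` off a null semialgebraic `Z` ⇒ lifting (`exists_liftCube`) and
  null-set excision ⇒ `x ≡ Σⱼ [□^{M'}, Dⱼ − (Gⱼ|₁ − Gⱼ|₀)]` ⇒ (S3) each summand is a relation);
* `kzKernelConjecture_of_fibrewiseStokesGenerationConjecture`, `kontsevichZagierPeriods_of_fibrewiseStokesGenerationConjecture`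
  (via the landed calibration `StokesGeneration ↔ summit`, `Negative/IffSummit.lean`);
* `stub_fibrewiseBridge` — the registered form.

So the crux now carries TWO recorded conditional bridges at theorem level: this one and Sketch's
`TypeAGenerationConjecture ∧ CubeNashNormalForm ⇒ summit` (`…LineReductionNamed.lean`).
[Kontsevich–Zagier 2001, §1.2 Conjecture 1; Ayoub 2015 Conj. 1.1 (transposed)]
-/

noncomputable section

set_option linter.dupNamespace false

namespace Summit.KontsevichZagierPeriods.KontsevichZagierPeriods.Cruxes.StokesGeneration.FibrewiseStokes

open MeasureTheory Set
open Literature.ModelTheory.ExponentialFields (IsSemialgebraic)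
open Literature.NumberTheory.Transcendental
open Literature.NumberTheory.Transcendental.KZ
open Summit.KontsevichZagierPeriods.KontsevichZagierPeriods (FibrewiseStokesGenerationConjecture)
open Summit.KontsevichZagierPeriods.KontsevichZagierPeriods.Theses.UnfoldedStokes (StokesGeneration)
open Summit.KontsevichZagierPeriods.KontsevichZagierPeriods.StokesGenerationLine (exists_liftCube)

/-! ## Null-set excision (glue) -/

/-- Splitting a representation along `σ = (σ ∖ Z) ∪ (σ ∩ Z)` (one domain-additivity move).
[cite: KontsevichZagier2001, §1.2 rule (1)] -/
theorem of_sub_restrict_sub_restrict_mem_relations {N : ℕ} (r : IntegralRep N)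
    (Z : Set (Fin N → ℝ)) (hZ : IsSemialgebraic ℚ Z) :
    of r - of (r.restrict (r.domain \ Z) (r.isSemialgebraic_domain.diff hZ) Set.sdiff_subset) -
      of (r.restrict (r.domain ∩ Z) (r.isSemialgebraic_domain.inter hZ) Set.inter_subset_left) ∈
      relations := by
  refine domainAddRel_subset_relations
    ⟨N, r, r.restrict (r.domain \ Z) (r.isSemialgebraic_domain.diff hZ) Set.sdiff_subset,
      r.restrict (r.domain ∩ Z) (r.isSemialgebraic_domain.inter hZ) Set.inter_subset_left,
      ?_, ?_, fun _ _ => rfl, fun _ _ => rfl, rfl⟩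
  · simp only [IntegralRep.domain_restrict]
    rw [Set.sdiff_union_inter]
  · simp only [IntegralRep.domain_restrict]
    have : (r.domain \ Z) ∩ (r.domain ∩ Z) = ∅ := by
      ext x
      simp only [mem_inter_iff, mem_sdiff, mem_empty_iff_false, iff_false, not_and]
      tauto
    rw [this, measure_empty]

/-- **Null-set excision.** If `t` and the `q j` share a domain and the integrand of `t` is the sum
of those of the `q j` off a `ℚ`-semialgebraic null set `Z`, then `[t] ≡ Σⱼ [q j]` modulo the moves.
[cite: KontsevichZagier2001, §1.2 rule (1)] -/
theorem of_sub_sum_mem_relations_of_eqOn_off_null {N J : ℕ} (t : IntegralRep N)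
    (q : Fin J → IntegralRep N) (Z : Set (Fin N → ℝ)) (hZ : IsSemialgebraic ℚ Z)
    (hZ0 : volume Z = 0) (hdom : ∀ j, (q j).domain = t.domain)
    (heq : ∀ x ∈ t.domain, x ∉ Z → t.integrand x = ∑ j, (q j).integrand x) :
    of t - ∑ j, of (q j) ∈ relations := by
  classical
  set tS := t.restrict (t.domain \ Z) (t.isSemialgebraic_domain.diff hZ) Set.sdiff_subset with htS
  set tZ := t.restrict (t.domain ∩ Z) (t.isSemialgebraic_domain.inter hZ) Set.inter_subset_left
    with htZ
  set qS : Fin J → IntegralRep N := fun j =>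
    (q j).restrict ((q j).domain \ Z) ((q j).isSemialgebraic_domain.diff hZ) Set.sdiff_subset with hqS
  set qZ : Fin J → IntegralRep N := fun j =>
    (q j).restrict ((q j).domain ∩ Z) ((q j).isSemialgebraic_domain.inter hZ) Set.inter_subset_left
    with hqZ
  have ht : of t - of tS - of tZ ∈ relations := of_sub_restrict_sub_restrict_mem_relations t Z hZ
  have hq : ∀ j, of (q j) - of (qS j) - of (qZ j) ∈ relations := fun j =>
    of_sub_restrict_sub_restrict_mem_relations (q j) Z hZ
  have hnull : ∀ s : Set (Fin N → ℝ), volume (s ∩ Z) = 0 := fun s =>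
    measure_mono_null Set.inter_subset_right hZ0
  have htZ0 : of tZ ∈ relations := of_mem_relations_of_volume_eq_zero tZ (hnull _)
  have hqZ0 : ∀ j, of (qZ j) ∈ relations := fun j => of_mem_relations_of_volume_eq_zero (qZ j) (hnull _)
  have hS : of tS - ∑ j, of (qS j) ∈ relations := by
    refine of_sub_sum_integrand_mem_relations Finset.univ qS tS (fun j _ => ?_) ?_
    · simp only [hqS, htS, IntegralRep.domain_restrict, hdom j]
    · intro x hx
      simp only [htS, IntegralRep.domain_restrict, mem_sdiff] at hx
      simp only [htS, hqS, IntegralRep.integrand_restrict]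
      exact heq x hx.1 hx.2
  have e : of t - ∑ j, of (q j) = (of t - of tS - of tZ) + of tZ + (of tS - ∑ j, of (qS j)) -
      ∑ j, (of (q j) - of (qS j) - of (qZ j)) - ∑ j, of (qZ j) := by
    simp only [Finset.sum_sub_distrib]; abel
  rw [e]
  refine relations.sub_mem (relations.sub_mem (relations.add_mem (relations.add_mem ht htZ0) hS)
    (AddSubgroup.sum_mem _ fun j _ => hq j)) (AddSubgroup.sum_mem _ fun j _ => hqZ0 j)

/-! ## The bridge -/

/-- **`FibrewiseStokesGenerationConjecture ⇒` the crux `StokesGeneration`** (S1 and S3 are the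
landed theorems `stub_cubifyKernel`, `stub_fibrewiseStokesCalibration`).
[cite: KontsevichZagier2001, §1.2 Conjecture 1] -/
theorem stokesGeneration_of_fibrewiseStokesGenerationConjecture
    (h2 : FibrewiseStokesGenerationConjecture) : StokesGeneration := by
  classical
  intro x hx
  refine AddSubgroup.mem_sup_left ?_
  -- (S1) one cube representation
  obtain ⟨M, t, htd, htB, hxt⟩ := stub_cubifyKernel x
  -- its value vanishes, by soundness
  have hval : t.value = 0 := by
    have h0 := relations_le_ker_eval_holds hxt
    rwa [AddMonoidHom.mem_ker, map_sub, hx, zero_sub, neg_eq_zero, eval_of] at h0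
  -- (S2) fibrewise decomposition on a bigger cube
  obtain ⟨M', hMM', J, i, G, D, K, q, Z, hpack, hq, hZs, hZ0, hident⟩ := h2 M t htd htB hval
  -- lift `t` to dimension `M'`
  obtain ⟨t'', ht''d, ht''i, hlift⟩ := exists_liftCube M M' hMM' t htd
  -- `[t''] ≡ Σⱼ [q j]` off the null set `Z`
  have hsum : of t'' - ∑ j, of (q j) ∈ relations := by
    refine of_sub_sum_mem_relations_of_eqOn_off_null t'' q Z hZs hZ0
      (fun j => by rw [(hq j).1, ht''d]) ?_
    intro z hz hzZ
    rw [ht''d] at hz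
    rw [ht''i z hz, hident z hz hzZ]
  -- (S3) each summand is a relation
  have hqrel : ∑ j, of (q j) ∈ relations :=
    AddSubgroup.sum_mem _ fun j _ =>
      stub_fibrewiseStokesCalibration M' (i j) (G j) (D j) (K j) (hpack j).1 (hpack j).2.1
        (hpack j).2.2.1 (hpack j).2.2.2.1 (hpack j).2.2.2.2.1 (hpack j).2.2.2.2.2.1
        (hpack j).2.2.2.2.2.2 (q j) (hq j).1 (hq j).2
  have e : x = (x - of t) + (of t - of t'') + (of t'' - ∑ j, of (q j)) + ∑ j, of (q j) := by abel
  rw [e]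
  exact relations.add_mem (relations.add_mem (relations.add_mem hxt hlift) hsum) hqrel

/-- **`FibrewiseStokesGenerationConjecture ⇒ KZKernelConjecture`.** [cite: KontsevichZagier2001, §1.2 Conjecture 1] -/
theorem kzKernelConjecture_of_fibrewiseStokesGenerationConjecture
    (h2 : FibrewiseStokesGenerationConjecture) : KZKernelConjecture :=
  Summit.KontsevichZagierPeriods.UnfoldedStokes.StokesGenerationNegative.stokesGeneration_iff_kernel.mp
    (stokesGeneration_of_fibrewiseStokesGenerationConjecture h2)

/-- **`FibrewiseStokesGenerationConjecture ⇒` the summit `KontsevichZagierPeriods`.**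
[cite: KontsevichZagier2001, §1.2 Conjecture 1] -/
theorem kontsevichZagierPeriods_of_fibrewiseStokesGenerationConjecture
    (h2 : FibrewiseStokesGenerationConjecture) : _root_.KontsevichZagierPeriods :=
  Summit.KontsevichZagierPeriods.UnfoldedStokes.StokesGenerationNegative.stokesGeneration_iff_summit.mp
    (stokesGeneration_of_fibrewiseStokesGenerationConjecture h2)

/-- The registered form (bookkeeping stub `stub_fibrewiseBridge`):
`FibrewiseStokesGenerationConjecture → StokesGeneration`. [cite: KontsevichZagier2001, §1.2 Conjecture 1] -/
theorem stub_fibrewiseBridge : FibrewiseStokesGenerationConjecture → StokesGeneration :=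
  stokesGeneration_of_fibrewiseStokesGenerationConjecture

end Summit.KontsevichZagierPeriods.KontsevichZagierPeriods.Cruxes.StokesGeneration.FibrewiseStokes
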